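import Mathlib.FieldTheory.Perfect
import Mathlib.FieldTheory.Minpoly.Field
import Mathlib.Algebra.Polynomial.Lifts
import Mathlib.RingTheory.Derivation.Basic
import Literature.NumberTheory.Transcendental.EclPregeometryProofs
import Literature.NumberTheory.Transcendental.SchanuelEclEmptyProofs
import HarnessLib

/-!
# Kirby 2010, Lemma 3.3: `ecl` is a closure operator of finite character — proofs

Second sibling proof file of `EclPregeometry.lean` (after `EclPregeometryProofs.lean`, which
proves that `ecl C` is an E-subfield). It DISCHARGES, for every field `K` with an E-ring
structure, the named facts

* `Literature.Kirby2010_ecl_idem K` — `ecl (ecl C) = ecl C` (`Kirby2010_ecl_idem_holds`);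
* `Literature.Kirby2010_ecl_finiteCharacter K` — `ecl C = ⋃ {ecl C₀ | C₀ ⊆ C finite}`
  (`Kirby2010_ecl_finiteCharacter_holds`);
* `Literature.Kirby2010_ecl_relAlgClosed K` for `K` of characteristic zero — `ecl C` is relatively
  algebraically closed in `K` (`Kirby2010_ecl_relAlgClosed_holds`; §7, proof of Prop. 7.1; false in
  characteristic `p` for the trivial exponential, see the docstring),

i.e. the remaining "closure operator" items of

> **Lemma 3.3** (J. Kirby, Bull. Lond. Math. Soc. 42 (2010), p. 4). If `R` is a partial E-domain
> then `ecl^R` is a closure operator with finite character. That is, for any subsets `C, B` of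
> `R` we have `C ⊆ ecl(C)`, `C ⊆ B ⟹ ecl(C) ⊆ ecl(B)`, `ecl(ecl(C)) = ecl(C)`,
> `ecl(C) = ⋃ {ecl(C₀) | C₀ a finite subset of C}`. […] *Proof.* A straightforward exercise.

(`subset_ecl`, `ecl_mono` are in `ZilberField.lean`). Together with `EclPregeometryProofs.lean`
this leaves, of the facts of `EclPregeometry.lean`, only the deep ones open: exchange (Thm. 1.1,
`ecl = cl`) and the weak Schanuel property (Thm. 1.2, Ax's theorem). Consequently Kirby's
reduction of Schanuel's conjecture to `ecl ∅` (`SchanuelEclEmptyProofs.lean`) now rests on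
Thm. 1.2 alone:
`Periods.schanuelConjecture_iff_ecl_empty_of_weakSchanuel`.

## The exercise

* *Idempotence* (`Khovanskii.ecl_ecl`). Let `a ∈ ecl (ecl C)` be witnessed by a Khovanskii system
  `f̄` in unknowns `x̄` with coefficients in `ℤ[ecl C] = ecl C` (a subring,
  `Khovanskii.eclSubfield`). Its finitely many coefficients are elements of `ecl C`, hence
  (iterating `IsSol.merge`, `Khovanskii.exists_isSol_forall_mem`) coordinates `x'_{w(i,m)}` of ONE
  Khovanskii solution `x̄'` of a system `ḡ` over `C`. Replace every coefficient of `fᵢ` by the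
  corresponding unknown: `Fᵢ = Σₘ X_{w(i,m)} (X̄,Ȳ)^m` has coefficients `1`, and `(x̄', x̄)` solves
  `(ḡ, F̄)` with block-triangular Jacobian `[[J_g, 0], [∗, J_f]]`
  (`Khovanskii.IsSol.substCoeffs`). Hence `a ∈ ecl C`.
* *Finite character* (`Khovanskii.exists_finset_mem_ecl`). A system has finitely many non-zero
  coefficients, each in the subring generated by a finite subset of `C`
  (`Khovanskii.exists_finset_mem_closure`, finite character of `Subring.closure`).
* *Relative algebraic closedness* (`Khovanskii.mem_ecl_of_isRoot`, characteristic zero). If `a`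
  is a root of a non-zero polynomial with coefficients in the subfield `E = ecl C`, its minimal
  polynomial `q ∈ E[X]` is separable (`PerfectField.ofCharZero`), so `q(a) = 0`, `q'(a) ≠ 0`
  (`Polynomial.Separable.aeval_derivative_ne_zero`) is a one-unknown Khovanskii system over
  `ecl C` (`Derivation.map_aeval` computes `∂/∂X` of `Polynomial.aeval X q`), whence
  `a ∈ ecl (ecl C) = ecl C`.

## References

* J. Kirby, *Exponential algebraicity in exponential fields*, Bull. Lond. Math. Soc. 42 (2010),
  879–890, doi:10.1112/blms/bdq044, arXiv:0810.4285: Lemma 3.3 (p. 4), §7 (proof of Prop. 7.1),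
  p. 3 (E-fields have characteristic zero).
-/

noncomputable section

open MvPolynomial

namespace Literature.NumberTheory.Transcendental

namespace Khovanskii

/-- At `ι = Fin n`, `Khovanskii.ePD` is the tree's `Literature.NumberTheory.Transcendental.expPDeriv` (`ZilberField.lean`),
definitionally; likewise `kjac` is the Jacobian appearing in `Literature.NumberTheory.Transcendental.ecl`.
[cite: Kirby2010, Def. 3.1] -/
theorem ePD_fin {K : Type*} [Field K] {n : ℕ} (j : Fin n) (f : MvPolynomial (Fin n ⊕ Fin n) K) :
    ePD j f = expPDeriv j f := rfl

end Khovanskii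

namespace Khovanskii

/-! ### Idempotence (Kirby 2010, Lemma 3.3, third item) -/

section Idem

variable {K : Type*} [Field K] [Literature.ModelTheory.ExponentialFields.ExponentialRing K] {C : Set K}

/-- The empty Khovanskii system. [folklore] -/
theorem IsSol.empty : IsSol C (fun i : PEmpty => (i.elim : K)) (fun i => i.elim) where
  coeff i := i.elim
  eval_eq i := i.elim
  det_ne := by rw [Matrix.det_isEmpty]; exact one_ne_zero

/-- Finitely many elements of `ecl C` are simultaneously coordinates of ONE Khovanskii solution
over `C` (iterated `IsSol.merge`). [cite: Kirby2010, Lemma 3.3] -/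
theorem exists_isSol_forall_mem (T : Finset K) (hT : ∀ t ∈ T, t ∈ ecl C) :
    ∃ (κ : Type) (_ : Fintype κ) (_ : DecidableEq κ) (x : κ → K)
      (g : κ → MvPolynomial (κ ⊕ κ) K), IsSol C x g ∧ ∀ t ∈ T, ∃ k, x k = t := by
  classical
  induction T using Finset.induction_on with
  | empty => exact ⟨PEmpty, inferInstance, inferInstance, _, _, IsSol.empty, by simp⟩
  | insert a T haT ih =>
    obtain ⟨κ, _, _, x, g, hx, hcov⟩ := ih fun t ht => hT t (Finset.mem_insert_of_mem ht)
    obtain ⟨ι, _, _, y, f, hy, i₀, hi₀⟩ :=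
      mem_ecl_iff.mp (hT a (Finset.mem_insert_self a T))
    refine ⟨κ ⊕ ι, inferInstance, inferInstance, _, _, hx.merge hy, ?_⟩
    intro t ht
    rcases Finset.mem_insert.mp ht with rfl | ht
    · exact ⟨Sum.inr i₀, hi₀⟩
    · obtain ⟨k, hk⟩ := hcov t ht
      exact ⟨Sum.inl k, hk⟩

omit [Literature.ModelTheory.ExponentialFields.ExponentialRing K] in
/-- `ePD j` is additive. [folklore] -/
theorem ePD_add {ι : Type*} (j : ι) (p q : MvPolynomial (ι ⊕ ι) K) :
    ePD j (p + q) = ePD j p + ePD j q := by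
  simp only [ePD, map_add]; ring

omit [Literature.ModelTheory.ExponentialFields.ExponentialRing K] in
/-- `ePD j` commutes with finite sums. [folklore] -/
theorem ePD_sum {ι : Type*} (j : ι) {α : Type*} (s : Finset α)
    (p : α → MvPolynomial (ι ⊕ ι) K) :
    ePD j (∑ a ∈ s, p a) = ∑ a ∈ s, ePD j (p a) :=
  map_sum (AddMonoidHom.mk' (ePD j) (ePD_add j)) p s

omit [Literature.ModelTheory.ExponentialFields.ExponentialRing K] in
/-- `ePD j` is `K`-linear (constants pass through). [folklore] -/
theorem ePD_C_mul {ι : Type*} (j : ι) (c : K) (p : MvPolynomial (ι ⊕ ι) K) :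
    ePD j (MvPolynomial.C c * p) = MvPolynomial.C c * ePD j p := by
  simp only [ePD, pderiv_C_mul]; ring

omit [Literature.ModelTheory.ExponentialFields.ExponentialRing K] in
/-- `∂/∂` of a "foreign" block variable times a renamed polynomial. [folklore] -/
theorem ePD_X_mul_rename {κ ι : Type*} (k : κ) (j : ι) (p : MvPolynomial (ι ⊕ ι) K) :
    ePD (Sum.inr j : κ ⊕ ι) (X (Sum.inl (Sum.inl k)) * rename (Sum.map Sum.inr Sum.inr) p) =
      X (Sum.inl (Sum.inl k)) * rename (Sum.map Sum.inr Sum.inr) (ePD j p) := by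
  rw [← ePD_rename Sum.inr_injective]
  simp only [ePD, Derivation.leibniz, smul_eq_mul, pderiv_X_of_ne (show
    (Sum.inl (Sum.inl k) : (κ ⊕ ι) ⊕ (κ ⊕ ι)) ≠ Sum.inl (Sum.inr j) from by simp),
    pderiv_X_of_ne (show (Sum.inl (Sum.inl k) : (κ ⊕ ι) ⊕ (κ ⊕ ι)) ≠ Sum.inr (Sum.inr j) from
      by simp)]
  ring

/-- **Replacing coefficients by unknowns.** Given a Khovanskii solution `x̄` of `f̄` whose
coefficients are themselves coordinates `x'_{w(i,m)}` of a Khovanskii solution `x̄'` of `ḡ` over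
`C`, the tuple `(x̄', x̄)` solves the system `ḡ, F̄` over `C` where
`Fᵢ = Σₘ X_{w(i,m)} · (X,Y)^m` has coefficients `1`: its Jacobian is block-triangular with diagonal
blocks those of `ḡ` and `f̄`. [cite: Kirby2010, Lemma 3.3] -/
theorem IsSol.substCoeffs {κ ι : Type*} [Fintype κ] [DecidableEq κ] [Fintype ι] [DecidableEq ι]
    {x' : κ → K} {g : κ → MvPolynomial (κ ⊕ κ) K} (hg : IsSol C x' g)
    {x : ι → K} {f : ι → MvPolynomial (ι ⊕ ι) K}
    (hfe : ∀ i, eval (kpt x) (f i) = 0) (hfd : (kjac x f).det ≠ 0)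
    (w : ι → ((ι ⊕ ι) →₀ ℕ) → κ) (hw : ∀ i m, x' (w i m) = (f i).coeff m) :
    IsSol C (Sum.elim x' x)
      (Sum.elim (fun k => rename (Sum.map Sum.inl Sum.inl) (g k))
        (fun i => ∑ m ∈ (f i).support,
          X (Sum.inl (Sum.inl (w i m))) * rename (Sum.map Sum.inr Sum.inr) (monomial m 1))) := by
  classical
  -- the key identity: substituting `x'` back for the new unknowns recovers `f i`
  have hF : ∀ i, f i = ∑ m ∈ (f i).support, MvPolynomial.C ((f i).coeff m) * monomial m 1 := by
    intro i
    conv_lhs => rw [(f i).as_sum]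
    refine Finset.sum_congr rfl fun m _ => ?_
    rw [C_mul_monomial, mul_one]
  refine ⟨?_, ?_, ?_⟩
  · rintro (k | i)
    · exact rename_mem_polyOver _ (hg.coeff k)
    · refine Subring.sum_mem _ fun m _ => Subring.mul_mem _ (X_mem_polyOver _ _)
        (rename_mem_polyOver _ ⟨monomial m 1, ?_⟩)
      rw [map_monomial, map_one]
  · rintro (k | i)
    · simp only [Sum.elim_inl]
      rw [eval_rename_map, Sum.elim_comp_inl, hg.eval_eq]
    · simp only [Sum.elim_inr, map_sum, map_mul, eval_X, kpt_inl, Sum.elim_inl]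
      simp_rw [eval_rename_map, Sum.elim_comp_inr, hw]
      rw [← hfe i]
      conv_rhs => rw [hF i, map_sum]
      refine Finset.sum_congr rfl fun m _ => ?_
      rw [map_mul, eval_C]
  · have : kjac (Sum.elim x' x) (Sum.elim (fun k => rename (Sum.map Sum.inl Sum.inl) (g k))
        (fun i => ∑ m ∈ (f i).support,
          X (Sum.inl (Sum.inl (w i m))) * rename (Sum.map Sum.inr Sum.inr) (monomial m 1))) =
        Matrix.fromBlocks (kjac x' g) 0
          (Matrix.of fun i k => eval (kpt (Sum.elim x' x)) (ePD (Sum.inl k)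
            (∑ m ∈ (f i).support,
              X (Sum.inl (Sum.inl (w i m))) * rename (Sum.map Sum.inr Sum.inr) (monomial m 1))))
          (kjac x f) := by
      ext s t
      rcases s with k | i <;> rcases t with k' | j
      · simp only [kjac, Matrix.of_apply, Matrix.fromBlocks_apply₁₁, Sum.elim_inl]
        rw [eval_ePD_rename _ Sum.inl_injective, Sum.elim_comp_inl]
      · simp only [kjac, Matrix.of_apply, Matrix.fromBlocks_apply₁₂, Sum.elim_inl,
          Matrix.zero_apply]
        rw [ePD_rename_of_notMem Sum.inl (by rintro ⟨_, h⟩; cases h), map_zero]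
      · simp only [kjac, Matrix.of_apply, Matrix.fromBlocks_apply₂₁, Sum.elim_inr]
      · simp only [kjac, Matrix.of_apply, Matrix.fromBlocks_apply₂₂, Sum.elim_inr]
        rw [ePD_sum]
        simp only [ePD_X_mul_rename, map_sum, map_mul, eval_X, kpt_inl, Sum.elim_inl]
        simp_rw [eval_rename_map, Sum.elim_comp_inr, hw]
        conv_rhs => rw [hF i, ePD_sum, map_sum]
        refine Finset.sum_congr rfl fun m _ => ?_
        rw [ePD_C_mul, map_mul, eval_C]
    rw [this, Matrix.det_fromBlocks_zero₁₂]
    exact mul_ne_zero hg.det_ne hfd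

/-- **Idempotence of `ecl`** (Kirby 2010, Lemma 3.3, `ecl(ecl C) = ecl C`): the coefficients of a
Khovanskii system over `ecl C` (finitely many elements of the subring `ecl C`) are coordinates of
one Khovanskii solution over `C`; replace them by unknowns (`IsSol.substCoeffs`).
[cite: Kirby2010, Lemma 3.3] -/
theorem ecl_ecl (C : Set K) : ecl (ecl C) = ecl C := by
  classical
  refine Set.Subset.antisymm ?_ (subset_ecl _)
  intro a ha
  obtain ⟨ι, _, _, x, f, hx, i₀, rfl⟩ := mem_ecl_iff.mp ha
  -- all coefficients lie in `ecl C`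
  have hcl : Subring.closure (ecl C) = (eclSubfield C).toSubring :=
    Subring.closure_eq (eclSubfield C).toSubring
  have hcoef : ∀ i m, (f i).coeff m ∈ ecl C := by
    intro i m
    have := mem_polyOver_iff.mp (hx.coeff i) m
    rwa [hcl] at this
  set T : Finset K := Finset.univ.biUnion fun i => (f i).coeffs with hT
  have hTecl : ∀ t ∈ insert (0 : K) T, t ∈ ecl C := by
    intro t ht
    rcases Finset.mem_insert.mp ht with rfl | ht
    · exact zero_mem_ecl C
    · obtain ⟨i, -, hi⟩ := Finset.mem_biUnion.mp ht
      obtain ⟨m, -, rfl⟩ := mem_coeffs_iff.mp hi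
      exact hcoef i m
  have hmemT : ∀ i m, (f i).coeff m ∈ insert (0 : K) T := by
    intro i m
    by_cases h0 : (f i).coeff m = 0
    · rw [h0]; exact Finset.mem_insert_self _ _
    · exact Finset.mem_insert_of_mem
        (Finset.mem_biUnion.mpr ⟨i, Finset.mem_univ _, coeff_mem_coeffs m h0⟩)
  obtain ⟨κ, _, _, x', g, hg, hcov⟩ := exists_isSol_forall_mem (insert (0 : K) T) hTecl
  choose w hw using fun i m => hcov _ (hmemT i m)
  have hs := hg.substCoeffs hx.eval_eq hx.det_ne w hw
  exact mem_ecl_iff.mpr ⟨κ ⊕ ι, inferInstance, inferInstance, _, _, hs, Sum.inr i₀, rfl⟩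

end Idem

end Khovanskii

/-- **Discharge of `Kirby2010_ecl_idem`** (Kirby 2010, Lemma 3.3, third item:
`ecl(ecl C) = ecl C`). [cite: Kirby2010, Lemma 3.3] -/
theorem Kirby2010_ecl_idem_holds (K : Type*) [Field K] [Literature.ModelTheory.ExponentialFields.ExponentialRing K] :
    Kirby2010_ecl_idem K := fun C => Khovanskii.ecl_ecl C


namespace Khovanskii

/-! ### Finite character (Kirby 2010, Lemma 3.3, fourth item) -/

section FiniteCharacter

variable {K : Type*} [Field K]

/-- Finite character of `Subring.closure`: an element of the subring generated by `s` lies in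
the subring generated by a finite subset of `s`. [folklore] -/
theorem exists_finset_mem_closure {s : Set K} {a : K} (ha : a ∈ Subring.closure s) :
    ∃ t : Finset K, (↑t : Set K) ⊆ s ∧ a ∈ Subring.closure (↑t : Set K) := by
  classical
  induction ha using Subring.closure_induction with
  | mem x hx => exact ⟨{x}, by simpa using hx, Subring.subset_closure (by simp)⟩
  | zero => exact ⟨∅, by simp, zero_mem _⟩
  | one => exact ⟨∅, by simp, one_mem _⟩
  | add x y _ _ hx hy =>
    obtain ⟨t₁, h₁, hx⟩ := hx
    obtain ⟨t₂, h₂, hy⟩ := hy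
    refine ⟨t₁ ∪ t₂, by simp [Set.union_subset_iff, h₁, h₂], add_mem ?_ ?_⟩
    · exact Subring.closure_mono (by simp) hx
    · exact Subring.closure_mono (by simp) hy
  | neg x _ hx =>
    obtain ⟨t, h, hx⟩ := hx
    exact ⟨t, h, neg_mem hx⟩
  | mul x y _ _ hx hy =>
    obtain ⟨t₁, h₁, hx⟩ := hx
    obtain ⟨t₂, h₂, hy⟩ := hy
    refine ⟨t₁ ∪ t₂, by simp [Set.union_subset_iff, h₁, h₂], mul_mem ?_ ?_⟩
    · exact Subring.closure_mono (by simp) hx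
    · exact Subring.closure_mono (by simp) hy

variable [Literature.ModelTheory.ExponentialFields.ExponentialRing K]

/-- **Finite character of `ecl`** (Kirby 2010, Lemma 3.3): a Khovanskii system over `C` has
finitely many coefficients, each in the subring generated by a finite subset of `C`.
[cite: Kirby2010, Lemma 3.3] -/
theorem exists_finset_mem_ecl {C : Set K} {a : K} (ha : a ∈ ecl C) :
    ∃ C₀ : Finset K, (↑C₀ : Set K) ⊆ C ∧ a ∈ ecl (↑C₀ : Set K) := by
  classical
  obtain ⟨n, x, f, hxa, hcoeff, heval, hdet⟩ := ha
  choose t ht hmem using fun i m => exists_finset_mem_closure (hcoeff i m)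
  refine ⟨Finset.univ.biUnion fun i => (f i).support.biUnion fun m => t i m, ?_,
    n, x, f, hxa, ?_, heval, hdet⟩
  · simp only [Finset.coe_biUnion, Finset.coe_univ, Set.mem_univ, Set.iUnion_true,
      Set.iUnion_subset_iff]
    exact fun i m _ => ht i m
  · intro i m
    by_cases hm : m ∈ (f i).support
    · refine Subring.closure_mono ?_ (hmem i m)
      intro c hc
      simp only [Finset.coe_biUnion, Finset.coe_univ, Set.mem_univ, Set.iUnion_true,
        Set.mem_iUnion, Finset.mem_coe]
      exact ⟨i, m, hm, hc⟩
    · rw [notMem_support_iff.mp hm]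
      exact zero_mem _

end FiniteCharacter

end Khovanskii

/-- **Discharge of `Kirby2010_ecl_finiteCharacter`** (Kirby 2010, Lemma 3.3, fourth item:
`ecl C = ⋃ {ecl C₀ | C₀ ⊆ C finite}`). [cite: Kirby2010, Lemma 3.3] -/
theorem Kirby2010_ecl_finiteCharacter_holds (K : Type*) [Field K] [Literature.ModelTheory.ExponentialFields.ExponentialRing K] :
    Kirby2010_ecl_finiteCharacter K := by
  intro C
  refine Set.Subset.antisymm ?_ ?_
  · intro a ha
    obtain ⟨C₀, hC₀, ha⟩ := Khovanskii.exists_finset_mem_ecl ha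
    exact Set.mem_iUnion₂.mpr ⟨C₀, hC₀, ha⟩
  · intro a ha
    obtain ⟨C₀, hC₀, ha⟩ := Set.mem_iUnion₂.mp ha
    exact ecl_mono hC₀ ha

/-- Every closure `ecl C` is `ecl`-closed (idempotence). [cite: Kirby2010, Lemma 3.3] -/
theorem isEclClosed_ecl {K : Type*} [Field K] [Literature.ModelTheory.ExponentialFields.ExponentialRing K] (C : Set K) :
    IsEclClosed (ecl C) :=
  Khovanskii.ecl_ecl C


namespace Khovanskii

/-! ### Relative algebraic closedness in characteristic zero (Kirby 2010, §7) -/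

section RelAlgClosed

variable {K : Type*} [Field K] [CharZero K] [Literature.ModelTheory.ExponentialFields.ExponentialRing K]

/-- In characteristic zero, `ecl C` is relatively algebraically closed in `K` (Kirby 2010, proof
of Prop. 7.1): an element algebraic over the subfield `ecl C` is a SIMPLE root of its (separable)
minimal polynomial, i.e. a one-unknown Khovanskii system over `ecl C`, so it lies in
`ecl (ecl C) = ecl C`. [cite: Kirby2010, §7 (proof of Prop. 7.1)] -/
theorem mem_ecl_of_isRoot {C : Set K} {a : K} {p : Polynomial K} (hp0 : p ≠ 0)
    (hcoef : ∀ n, p.coeff n ∈ ecl C) (hroot : p.IsRoot a) : a ∈ ecl C := by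
  classical
  set E := eclSubfield C with hE
  -- lift `p` to `E[X]`: `a` is algebraic over `E`
  obtain ⟨p₀, hp₀⟩ : ∃ p₀ : Polynomial E, p₀.map (algebraMap E K) = p := by
    have : p ∈ Polynomial.lifts (algebraMap E K) := by
      rw [Polynomial.lifts_iff_coeff_lifts]
      intro n
      exact ⟨⟨p.coeff n, hcoef n⟩, rfl⟩
    exact (Polynomial.mem_lifts p).mp this
  have hp₀0 : p₀ ≠ 0 := by
    rintro rfl
    rw [Polynomial.map_zero] at hp₀
    exact hp0 hp₀.symm
  have halg : IsAlgebraic E a := by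
    refine ⟨p₀, hp₀0, ?_⟩
    rw [Polynomial.aeval_def, ← Polynomial.eval_map, hp₀]
    exact hroot
  have hint : IsIntegral E a := halg.isIntegral
  set q := minpoly E a with hq
  have hqsep : q.Separable := (minpoly.irreducible hint).separable
  have hqa : Polynomial.aeval a q = 0 := minpoly.aeval E a
  have hqd : Polynomial.aeval a (Polynomial.derivative q) ≠ 0 :=
    hqsep.aeval_derivative_ne_zero hqa
  -- the one-unknown Khovanskii system `q(X) = 0` over `ecl C`
  set q' : Polynomial K := q.map (algebraMap E K) with hq'
  set P : MvPolynomial (Unit ⊕ Unit) K := Polynomial.aeval (X (Sum.inl ())) q' with hP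
  have hevalP : ∀ r : Polynomial K, eval (kpt fun _ : Unit => a)
      (Polynomial.aeval (X (Sum.inl ()) : MvPolynomial (Unit ⊕ Unit) K) r) =
        Polynomial.aeval a r := by
    intro r
    have h1 := (Polynomial.aeval_algHom_apply (MvPolynomial.aeval (R := K) (kpt fun _ : Unit => a))
      (X (Sum.inl ()) : MvPolynomial (Unit ⊕ Unit) K) r).symm
    rw [MvPolynomial.aeval_X, kpt_inl] at h1
    rw [← h1]
    rfl
  have hmem : a ∈ ecl (ecl C) := by
    rw [mem_ecl_iff]
    refine ⟨Unit, inferInstance, inferInstance, fun _ => a, fun _ => P,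
      IsSol.single a P ?_ ?_ ?_, (), rfl⟩
    · rw [hP, Polynomial.aeval_eq_sum_range]
      refine Subring.sum_mem _ fun n _ => ?_
      rw [Algebra.smul_def, algebraMap_eq]
      refine Subring.mul_mem _ (C_mem_polyOver (Subring.subset_closure ?_))
        (Subring.pow_mem _ (X_mem_polyOver _ _) _)
      rw [hq', Polynomial.coeff_map]
      exact (q.coeff n).2
    · rw [hP, hevalP, hq', Polynomial.aeval_map_algebraMap]
      exact hqa
    · rw [ePD, hP, (pderiv (Sum.inl ())).map_aeval, (pderiv (Sum.inr ())).map_aeval]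
      simp only [pderiv_X_self, pderiv_X_of_ne (show (Sum.inl () : Unit ⊕ Unit) ≠ Sum.inr () from
        Sum.inl_ne_inr), smul_eq_mul, mul_one, mul_zero, add_zero]
      rw [hevalP, hq', Polynomial.derivative_map, Polynomial.aeval_map_algebraMap]
      exact hqd
  rwa [ecl_ecl] at hmem

end RelAlgClosed

end Khovanskii

/-- **Discharge of `Kirby2010_ecl_relAlgClosed` in characteristic zero** (Kirby 2010, §7, proof
of Prop. 7.1: "`ecl^F(C)` [is] relatively algebraically closed in `F`"; Kirby's E-fields have
characteristic zero by convention, p. 3). The `CharZero` hypothesis is necessary: for the trivial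
exponential on `𝔽_p(t)` and `C = {tᵖ}` one has `ecl C = 𝔽_p(tᵖ) ∌ t` although `t` is a root of
`Xᵖ − tᵖ`. [cite: Kirby2010, §7 (proof of Prop. 7.1)] -/
theorem Kirby2010_ecl_relAlgClosed_holds (K : Type*) [Field K] [CharZero K] [Literature.ModelTheory.ExponentialFields.ExponentialRing K] :
    Kirby2010_ecl_relAlgClosed K :=
  fun _ _ _ hp0 hcoef hroot => Khovanskii.mem_ecl_of_isRoot hp0 hcoef hroot

/-! ### Consequence for the named fact `Periods.schanuelConjecture_iff_ecl_empty` -/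

/-- With Lemma 3.3 discharged (`Kirby2010_ecl_idem_holds`, `Kirby2010_ecl_isExpSubfield_holds`),
Kirby's reduction `Periods.schanuelConjecture_iff_ecl_empty_of_Kirby2010` needs only Kirby's
Thm. 1.2 for `ℂ_exp` (`Kirby2010_weakSchanuel ℂ`, i.e. Ax's theorem) as hypothesis.
[cite: Kirby2010, Prop. 7.2] -/
theorem schanuelConjecture_iff_ecl_empty_of_weakSchanuel (h : Kirby2010_weakSchanuel ℂ) :
    Transcendental.schanuelConjecture_iff_ecl_empty :=
  Transcendental.schanuelConjecture_iff_ecl_empty_of_Kirby2010 h (Kirby2010_ecl_idem_holds ℂ)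
    (Kirby2010_ecl_isExpSubfield_holds ℂ)

/-- Likewise `kirby_relative_schanuel_complex` (Thm. 1.2 at `C = ecl ∅`) follows from the general
form `Kirby2010_weakSchanuel ℂ` alone. [cite: Kirby2010, Thm. 1.2] -/
theorem kirby_relative_schanuel_complex_of_weakSchanuel' (h : Kirby2010_weakSchanuel ℂ) :
    kirby_relative_schanuel_complex :=
  Transcendental.kirby_relative_schanuel_complex_of_weakSchanuel h (Kirby2010_ecl_idem_holds ℂ)

end Literature.NumberTheory.Transcendental
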